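import Literature.NumberTheory.CubicFields.CubicResolventCharacter
import Literature.NumberTheory.LFunctions.CubicRayClassGeneratorsQuadratic
import Literature.NumberTheory.CubicFields.ThreeTorsionBridge
import Mathlib.NumberTheory.NumberField.ClassNumber
import HarnessLib

/-!
# Cyclic cubic fields of discriminant `f²` are at most `3⁹ · 3^{ω(f)}`

`Proofs` file (theorems only), topic `Literature/NumberTheory/CubicFields`: the per-discriminant
bound of the uniformity estimate in the degenerate case `D₀ = 1` of the resolvent discriminant
(`d_K = f²` a square, `K` cyclic cubic): `cubicFieldCountOfDisc (f²) ≤ 3⁹ · 3^{ω(f)}`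
(`cubicFieldCountOfDisc_sq_le`), by the same class-field-theoretic injection as in
`UniformityPerDiscQuadratic` but over the base field `ℚ`: a cubic field of square discriminant is
Galois (`isGalois_of_discr_eq_sq`: otherwise `√d_K ∉ ℚ`, `DiscriminantSquareRoot`), hence abelian
cubic over `ℚ`, unramified outside the primes `T` dividing `3f²`; its cubic ray class character modulo
a `T`-supported modulus determines it (Bauer), and there are at most `3^{#S} · #Cl(ℤ)[3] = 3^{#S}`
such characters with `#S ≤ 9 + ω(f)` (`exists_generators_baseModulus`, class number one of `ℚ`).
(Classically: cyclic cubic fields of conductor `m` correspond to pairs of cubic Dirichlet characters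
of conductor `m`, Hasse 1930 / Davenport–Heilbronn 1971 §6.)  TECHNICAL NOTE: the class-field-theoretic
lemmas of the tree are stated for `IntermediateField K (AlgebraicClosure K)` over a number field `K`, whose
instance path at `K := ℚ` differs (reducibly) from the `ℚ`-algebra instances synthesized directly
(`DivisionRing.toRatAlgebra`); we therefore work over an auxiliary number field `k` of degree `1` and
specialize `k := ℚ` only in the final, instance-free inequality.

## References

* H. Davenport, H. Heilbronn, *On the density of discriminants of cubic fields. II*, Proc. Roy. Soc.
  A 322 (1971), §6 [DavenportHeilbronn1971].
* H. Hasse, *Arithmetische Theorie der kubischen Zahlkörper auf klassenkörpertheoretischer Grundlage*,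
  Math. Z. 31 (1930) [Hasse1930].
-/

noncomputable section

open NumberField Module IntermediateField IsDedekindDomain
open scoped Pointwise

namespace Literature.NumberTheory.CubicFields

open Literature.NumberTheory.NumberFields Literature.NumberTheory.QuadraticFields
  Literature.NumberTheory.GaloisRepresentations Literature.NumberTheory.LFunctions
  Literature.NumberTheory.Automorphic

/-! ### A cubic field of square discriminant is Galois -/

/-- **A cubic number field with square discriminant is Galois (cyclic).**  Otherwise its normal closure
`N` has degree `6` and contains `δ` with `δ² = d_K` and `δ ∉ ℚ`
(`exists_sq_eq_discr_mem_fixedField_not_mem_range`), impossible for `d_K = f²`.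
[cite: Marcus2018, Ch. 2 (discriminants and embeddings)] -/
theorem isGalois_of_discr_eq_sq (K : Type) [Field K] [NumberField K] (hK : finrank ℚ K = 3) {f : ℤ}
    (hd : discr K = f ^ 2) : IsGalois ℚ K := by
  classical
  by_contra hG
  set Ω := AlgebraicClosure K with hΩ
  haveI : CharZero Ω := charZero_of_injective_algebraMap (algebraMap K Ω).injective
  haveI hIAC : IsAlgClosure ℚ Ω :=
    Literature.NumberTheory.CubicFields.isAlgClosure_rat_algebraicClosure (k := K)
  haveI : Algebra.IsAlgebraic ℚ Ω := hIAC.isAlgebraic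
  haveI : Normal ℚ Ω := IsAlgClosure.normal ℚ Ω
  set ι₀ : K →ₐ[ℚ] Ω := IsAlgClosed.lift with hι₀
  haveI : Nonempty (K →ₐ[ℚ] Ω) := ⟨ι₀⟩
  set N : IntermediateField ℚ Ω := normalClosure ℚ K Ω with hNdef
  haveI : FiniteDimensional ℚ N := normalClosure.is_finiteDimensional ℚ K Ω
  haveI : Normal ℚ N := normalClosure.normal ℚ K Ω
  haveI : Algebra.IsSeparable ℚ N := Algebra.IsAlgebraic.isSeparable_of_perfectField
  haveI : IsGalois ℚ N := IsGalois.mk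
  set ι : K →ₐ[ℚ] N := (normalClosure.algHomEquiv ℚ K Ω).symm ι₀ with hιdef
  have hcard : Fintype.card (K →ₐ[ℚ] N) = finrank ℚ K :=
    (Fintype.card_congr (normalClosure.algHomEquiv ℚ K Ω)).trans (AlgHom.card ℚ K Ω)
  have hgen : (⨆ σ : K →ₐ[ℚ] N, σ.fieldRange) = ⊤ := by
    have h := (Algebra.IsAlgebraic.isNormalClosure_iff.mp (isNormalClosure_normalClosure ℚ K Ω)).2
    rwa [normalClosure_def] at h
  -- `[N : ℚ] ≥ 6`
  set F : IntermediateField ℚ N := ι.fieldRange with hFdef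
  have hF3 : finrank ℚ F = 3 := by
    rw [← hK]; exact (LinearEquiv.finrank_eq (AlgEquiv.ofInjectiveField ι).toLinearEquiv).symm
  have hFtop : F ≠ ⊤ := by
    intro htop
    apply hG
    have e : K ≃ₐ[ℚ] N :=
      (AlgEquiv.ofInjectiveField ι).trans ((IntermediateField.equivOfEq htop).trans IntermediateField.topEquiv)
    exact IsGalois.of_algEquiv e.symm
  have hrel : 2 ≤ finrank F N := by
    have h1 : finrank F N ≠ 1 := fun h1 => hFtop (IntermediateField.finrank_eq_one_iff_eq_top.mp h1)
    have h0 : 0 < finrank F N := finrank_pos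
    omega
  have hN6 : 6 ≤ finrank ℚ N := by
    haveI : Module.Free F N := Module.Free.of_divisionRing F N
    haveI : Module.Free ℚ F := Module.Free.of_divisionRing ℚ F
    rw [← Module.finrank_mul_finrank ℚ F N, hF3]
    nlinarith
  have hbig : (finrank ℚ K).factorial < 2 * Nat.card (N ≃ₐ[ℚ] N) := by
    rw [hK, IsGalois.card_aut_eq_finrank]
    have : (3 : ℕ).factorial = 6 := rfl
    omega
  have hodd : Odd (Nat.card (⊥ : Subgroup (N ≃ₐ[ℚ] N))) := by
    rw [Subgroup.card_bot]; exact odd_one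
  obtain ⟨δ, -, hδsq, hδnot⟩ :=
    exists_sq_eq_discr_mem_fixedField_not_mem_range K N hcard (by rw [hK]; norm_num) hgen hbig ⊥ hodd
  rw [hd, Int.cast_pow] at hδsq
  apply hδnot
  rcases sq_eq_sq_iff_eq_or_eq_neg.mp hδsq with h | h
  · exact ⟨(f : ℚ), by rw [h, map_intCast]⟩
  · exact ⟨-(f : ℚ), by rw [h, map_neg, map_intCast]⟩

/-! ### Number fields of degree one -/

section DegreeOne

variable {k : Type} [Field k] [NumberField k]

/-- A number field of degree `1` is `ℚ`: the structure map is a bijection. [folklore] -/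
theorem bijective_algebraMap_of_finrank_eq_one (hk : finrank ℚ k = 1) :
    Function.Bijective (algebraMap ℚ k) :=
  Algebra.finrank_eq_one_iff_bijective_algebraMap.mp hk  -- Mathlib; librarian dedup-02259

/-- In a number field of degree `1`, every algebraic integer is a rational integer. [folklore] -/
theorem exists_intCast_eq_of_finrank_eq_one (hk : finrank ℚ k = 1) (x : 𝓞 k) : ∃ m : ℤ, x = m := by
  obtain ⟨q, hq⟩ := (bijective_algebraMap_of_finrank_eq_one hk).2 (x : k)
  have hint : IsIntegral ℤ q := by
    have hx : IsIntegral ℤ (x : k) := x.2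
    rw [← hq] at hx
    exact (isIntegral_algebraMap_iff (algebraMap ℚ k).injective).mp hx
  obtain ⟨m, hm⟩ := IsIntegrallyClosed.isIntegral_iff.mp hint
  refine ⟨m, RingOfIntegers.coe_injective ?_⟩
  change (x : k) = ((m : 𝓞 k) : k)
  rw [← hq, ← hm, eq_intCast, map_intCast, RingOfIntegers.coe_eq_algebraMap, map_intCast]

/-- In a number field of degree `1`, distinct primes lie over distinct rational primes. [folklore] -/
theorem eq_of_natCast_mem_of_finrank_eq_one (hk : finrank ℚ k = 1) {ℓ : ℕ} (hℓ : ℓ.Prime)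
    (v w : HeightOneSpectrum (𝓞 k))
    (hv : ((ℓ : ℤ) : 𝓞 k) ∈ v.asIdeal) (hw : ((ℓ : ℤ) : 𝓞 k) ∈ w.asIdeal) : v = w := by
  obtain ⟨ℓ₁, hℓ₁, hiff₁⟩ := exists_ratPrime v
  obtain ⟨ℓ₂, hℓ₂, hiff₂⟩ := exists_ratPrime w
  have h₁ : ℓ₁ = ℓ := by
    by_contra hne
    exact not_mem_of_prime_ne hℓ hℓ₁ (Ne.symm hne) v hv ((hiff₁ ℓ₁).mpr dvd_rfl)
  have h₂ : ℓ₂ = ℓ := by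
    by_contra hne
    exact not_mem_of_prime_ne hℓ hℓ₂ (Ne.symm hne) w hw ((hiff₂ ℓ₂).mpr dvd_rfl)
  subst h₁; subst h₂
  refine HeightOneSpectrum.ext (le_antisymm (fun x hx => ?_) (fun x hx => ?_))
  · obtain ⟨m, rfl⟩ := exists_intCast_eq_of_finrank_eq_one hk x
    exact (hiff₂ m).mpr ((hiff₁ m).mp hx)
  · obtain ⟨m, rfl⟩ := exists_intCast_eq_of_finrank_eq_one hk x
    exact (hiff₁ m).mpr ((hiff₂ m).mp hx)

end DegreeOne

/-! ### The cubic ray class character of a cyclic cubic field, over a base of degree one -/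

section Aux

variable {k : Type} [Field k] [NumberField k]

open scoped Classical in
/-- **The cubic Dirichlet character of a cyclic cubic field** (over an auxiliary base `k` of degree
`1`).  A cyclic cubic field `K`, embedded in `k̄` as `L ⊇ k`, is abelian cubic over `k`, unramified at
the primes outside any `T` off which `d_K` is a unit; an injective character `χ` of `Gal(L/k) ≅ C₃` gives
the function `ψ(𝔭) = ω_χ(ϖ_𝔭)` off `T`, a cubic ray class character modulo a nonzero `T`-supported
modulus. [cite: DavenportHeilbronn1971, §6] -/
theorem exists_cubicRayClassFunction_cyclic (hk : finrank ℚ k = 1) (K : Type) [Field K] [NumberField K]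
    [IsGalois ℚ K] (hK : finrank ℚ K = 3) (T : Finset (HeightOneSpectrum (𝓞 k)))
    (hTd : ∀ v : HeightOneSpectrum (𝓞 k), v ∉ T → ((discr K : ℤ) : 𝓞 k) ∉ v.asIdeal) :
    ∃ (L : IntermediateField k (AlgebraicClosure k)) (_ : FiniteDimensional k L) (_ : IsAbelianGalois k L)
      (_ : NumberField L) (χ : (L ≃ₐ[k] L) →* ℂˣ),
      Function.Injective χ ∧ Nonempty (K ≃ₐ[ℚ] L) ∧
      (∀ v : HeightOneSpectrum (𝓞 k), v ∉ T → Algebra.IsUnramifiedIn (𝓞 L) v.asIdeal) ∧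
      ((∃ 𝔪 : Ideal (𝓞 k), 𝔪 ≠ ⊥ ∧ (∀ v : HeightOneSpectrum (𝓞 k), 𝔪 ≤ v.asIdeal → v ∈ T) ∧
          IsRayClassCharacter 𝔪 (fun v => if v ∈ T then (0 : ℂ) else
            (charHecke L χ artinReciprocity_character_holds).valueAtUniformizer v)) ∧
        (∀ v : HeightOneSpectrum (𝓞 k), v ∉ T → (fun v => if v ∈ T then (0 : ℂ) else
            (charHecke L χ artinReciprocity_character_holds).valueAtUniformizer v) v ^ 3 = 1) ∧
        (∀ v ∈ T, (fun v => if v ∈ T then (0 : ℂ) else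
            (charHecke L χ artinReciprocity_character_holds).valueAtUniformizer v) v = 0) ∧
        ∀ z ∈ ({1} : Set (𝓞 k)),
          idealPow k (fun v => if v ∈ T then (0 : ℂ) else
            (charHecke L χ artinReciprocity_character_holds).valueAtUniformizer v) (Ideal.span {z}) = 1) := by
  -- an embedding `K → k̄`; its image contains `k` (degree one)
  set ι₀ : K →ₐ[ℚ] AlgebraicClosure k := IsAlgClosed.lift with hι₀
  have hkmem : ∀ x : k, algebraMap k (AlgebraicClosure k) x ∈ ι₀.fieldRange.toSubfield := by
    intro x
    obtain ⟨q, rfl⟩ := (bijective_algebraMap_of_finrank_eq_one hk).2 x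
    rw [IntermediateField.mem_toSubfield, AlgHom.mem_fieldRange]
    exact ⟨algebraMap ℚ K q, by rw [AlgHom.commutes, ← IsScalarTower.algebraMap_apply]⟩
  set L : IntermediateField k (AlgebraicClosure k) := ι₀.fieldRange.toSubfield.toIntermediateField hkmem
    with hLdef
  have hmemL : ∀ y, y ∈ L ↔ ∃ x, ι₀ x = y := fun y => by
    rw [hLdef, ← IntermediateField.mem_toSubfield, Subfield.toIntermediateField_toSubfield,
      IntermediateField.mem_toSubfield, AlgHom.mem_fieldRange]
  -- `K ≃ L` over `ℚ`
  set f : K →ₐ[ℚ] L :=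
    { toFun := fun x => ⟨ι₀ x, (hmemL _).mpr ⟨x, rfl⟩⟩
      map_one' := Subtype.ext (map_one ι₀)
      map_mul' := fun x y => Subtype.ext (map_mul ι₀ x y)
      map_zero' := Subtype.ext (map_zero ι₀)
      map_add' := fun x y => Subtype.ext (map_add ι₀ x y)
      commutes' := fun q => Subtype.ext (by
        change ι₀ (algebraMap ℚ K q) = ((algebraMap ℚ L q : L) : AlgebraicClosure k)
        rw [AlgHom.commutes, IsScalarTower.algebraMap_apply ℚ L (AlgebraicClosure k)]
        rfl) } with hfdef
  have hfbij : Function.Bijective f := by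
    refine ⟨f.injective, fun y => ?_⟩
    obtain ⟨x, hx⟩ := (hmemL y).mp y.2
    exact ⟨x, Subtype.ext hx⟩
  set e : K ≃ₐ[ℚ] L := AlgEquiv.ofBijective f hfbij with hedef
  -- instances on `L`
  haveI hfdQ : FiniteDimensional ℚ L := LinearEquiv.finiteDimensional e.toLinearEquiv
  haveI hfd : FiniteDimensional k L := Module.Finite.of_restrictScalars_finite ℚ k L
  haveI : IsGalois ℚ L := IsGalois.of_algEquiv e
  haveI hgal : IsGalois k L := IsGalois.tower_top_of_isGalois ℚ k L
  have hLQ : finrank ℚ L = 3 := by rw [← LinearEquiv.finrank_eq e.toLinearEquiv, hK]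
  have hkL : finrank k L = 3 := by
    have := Module.finrank_mul_finrank ℚ k L
    rw [hk, hLQ, one_mul] at this
    exact this
  have hcard : Nat.card (L ≃ₐ[k] L) = 3 := by rw [IsGalois.card_aut_eq_finrank, hkL]
  haveI : Fact (Nat.Prime 3) := ⟨Nat.prime_three⟩
  haveI : IsCyclic (L ≃ₐ[k] L) := isCyclic_of_prime_card hcard
  haveI : IsMulCommutative (L ≃ₐ[k] L) := ⟨⟨IsCyclic.commGroup.mul_comm⟩⟩
  haveI hab : IsAbelianGalois k L := {}
  haveI : CharZero L := charZero_of_injective_algebraMap (algebraMap ℚ L).injective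
  haveI hnf : NumberField L := NumberField.mk
  obtain ⟨χ, hχ⟩ := exists_injective_character L hcard
  have hdiscL : discr L = discr K := (NumberField.discr_eq_discr_of_algEquiv K e).symm
  have hunr : ∀ v : HeightOneSpectrum (𝓞 k), v ∉ T → Algebra.IsUnramifiedIn (𝓞 L) v.asIdeal :=
    fun v hv => isUnramifiedIn_of_intCast_not_mem L (d := discr K)
      (fun p _ hpL => by rwa [hdiscL] at hpL) v (hTd v hv)
  obtain ⟨hray, hcube, hzero⟩ := cubicRayClassFunction_spec L χ hcard T hunr
  refine ⟨L, hfd, hab, hnf, χ, hχ, ⟨e⟩, hunr, hray, hcube, hzero, ?_⟩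
  intro z hz
  rw [Set.mem_singleton_iff.mp hz, Ideal.span_singleton_one]
  exact idealPow_top _

/-! ### The count, over a base of degree one -/

open scoped Classical in
/-- **`#{K : d_K = f²}/≅ ≤ 3^{#(𝓞_k/9) + ω(f)} · #Cl(k)[3]`** for any number field `k` of degree `1`
(`f ≠ 0`): cyclic cubic fields of discriminant `f²` inject (Bauer, via their cubic ray class characters off
the primes dividing `3f²`) into a set of at most `3^{#S} · #Cl(k)[3]` functions, `#S ≤ #(𝓞_k/9) + ω(f)`.
[cite: DavenportHeilbronn1971, §6] -/
theorem cubicFieldCountOfDisc_sq_le_aux (hk : finrank ℚ k = 1) {f : ℤ} (hf : f ≠ 0) :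
    cubicFieldCountOfDisc (f ^ 2) ≤
      3 ^ (Nat.card (𝓞 k ⧸ Ideal.span {(9 : 𝓞 k)}) + f.natAbs.primeFactors.card) *
        Nat.card {c : ClassGroup (𝓞 k) // c ^ 3 = 1} := by
  set d : ℤ := f ^ 2 with hddef
  have hd0 : d ≠ 0 := pow_ne_zero 2 hf
  have h3d : ((3 * d : ℤ) : 𝓞 k) ≠ 0 := by exact_mod_cast (mul_ne_zero (by norm_num) hd0)
  have hI : Ideal.span {((3 * d : ℤ) : 𝓞 k)} ≠ ⊥ := by rwa [Ne, Ideal.span_singleton_eq_bot]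
  set T : Finset (HeightOneSpectrum (𝓞 k)) := (Ideal.finite_factors hI).toFinset with hTdef
  have hT : ∀ v : HeightOneSpectrum (𝓞 k), v ∈ T ↔ ((3 * d : ℤ) : 𝓞 k) ∈ v.asIdeal := by
    intro v
    rw [hTdef, Set.Finite.mem_toFinset, Set.mem_setOf_eq, Ideal.dvd_span_singleton]
  have hT3 : ∀ v : HeightOneSpectrum (𝓞 k), (3 : 𝓞 k) ∈ v.asIdeal → v ∈ T := fun v h3 =>
    (hT v).mpr (by rw [Int.cast_mul, Int.cast_ofNat]; exact Ideal.mul_mem_right _ _ h3)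
  have hTd : ∀ v : HeightOneSpectrum (𝓞 k), v ∉ T → ((d : ℤ) : 𝓞 k) ∉ v.asIdeal :=
    fun v hv hmem => hv ((hT v).mpr (by rw [Int.cast_mul]; exact Ideal.mul_mem_left _ _ hmem))
  have hTne : T.Nonempty := by
    obtain ⟨v, hv⟩ := exists_mem_of_prime (K := k) Nat.prime_three
    exact ⟨v, hT3 v (by exact_mod_cast hv)⟩
  -- generators (`Z = {1}`)
  have hZT : ∀ z ∈ ({1} : Set (𝓞 k)), ∀ v ∈ T, z ∉ v.asIdeal := by
    intro z hz v _ hmem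
    rw [Set.mem_singleton_iff.mp hz] at hmem
    exact v.isPrime.ne_top ((Ideal.eq_top_iff_one _).mpr hmem)
  obtain ⟨S, hScard, hST, hgen0⟩ := exists_generators_baseModulus T hT3
  have hgen : ∀ x : 𝓞 k, (∀ v ∈ T, x ∉ v.asIdeal) → ∃ z ∈ ({1} : Set (𝓞 k)), ∃ n : 𝓞 k → ℕ,
      x - z * ∏ s ∈ S, s ^ n s ∈
        (∏ v ∈ T.filter (fun v => (3 : 𝓞 k) ∉ v.asIdeal), v.asIdeal) * Ideal.span {(9 : 𝓞 k)} := by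
    intro x hx
    obtain ⟨n, hn⟩ := hgen0 x hx
    exact ⟨1, rfl, n, by rwa [one_mul]⟩
  obtain ⟨hΨfin, hΨcard⟩ := ncard_cubicRayClassFunctions_le T hTne hT3 hZT S hST hgen
  -- the data attached to each cubic field of discriminant `f²`
  have hdata : ∀ F : cubicSubfieldsOfDisc d, _ := fun F => by
    haveI : IsGalois ℚ F.1 := isGalois_of_discr_eq_sq F.1 F.2.1 F.2.2
    exact exists_cubicRayClassFunction_cyclic hk F.1 F.2.1 T (fun v hv => by rw [F.2.2]; exact hTd v hv)
  choose L hLfd hLab hLnf χ hχ hemb hunr hΨ using hdata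
  set hR := artinReciprocity_character_holds
  set Ψ : Set (HeightOneSpectrum (𝓞 k) → ℂ) := {ψ |
      (∃ 𝔪 : Ideal (𝓞 k), 𝔪 ≠ ⊥ ∧ (∀ v : HeightOneSpectrum (𝓞 k), 𝔪 ≤ v.asIdeal → v ∈ T) ∧
        IsRayClassCharacter 𝔪 ψ) ∧
      (∀ v, v ∉ T → ψ v ^ 3 = 1) ∧ (∀ v ∈ T, ψ v = 0) ∧
      ∀ z ∈ ({1} : Set (𝓞 k)), idealPow k ψ (Ideal.span {z}) = 1} with hΨdef
  haveI : Finite Ψ := hΨfin.to_subtype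
  set ψ : cubicSubfieldsOfDisc d → (HeightOneSpectrum (𝓞 k) → ℂ) := fun F => by
    haveI := hLfd F; haveI := hLab F; haveI := hLnf F
    exact fun v => if v ∈ T then (0 : ℂ) else (charHecke (L F) (χ F) hR).valueAtUniformizer v
    with hψdef
  have hψmem : ∀ F, ψ F ∈ Ψ := fun F => hΨ F
  set Φ : CubicFieldClassesOfDisc d → Ψ := fun c => ⟨ψ c.out, hψmem c.out⟩ with hΦdef
  have hΦ : Function.Injective Φ := by
    intro c₁ c₂ hc
    have hψeq : ψ c₁.out = ψ c₂.out := congrArg Subtype.val hc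
    haveI := hLfd c₁.out; haveI := hLab c₁.out; haveI := hLnf c₁.out
    haveI := hLfd c₂.out; haveI := hLab c₂.out; haveI := hLnf c₂.out
    obtain ⟨e₁⟩ := hemb c₁.out
    obtain ⟨e₂⟩ := hemb c₂.out
    have hL : L c₁.out = L c₂.out :=
      eq_of_cubicRayClassFunction_eq (L c₁.out) (L c₂.out) (χ c₁.out) (χ c₂.out) (hχ c₁.out) (hχ c₂.out)
        T (hunr c₁.out) (hunr c₂.out) hψeq
    have hiso : Nonempty ((c₁.out : cubicSubfieldsOfDisc d).1 ≃ₐ[ℚ] (c₂.out : cubicSubfieldsOfDisc d).1) :=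
      ⟨e₁.trans (((IntermediateField.equivOfEq hL).restrictScalars ℚ).trans e₂.symm)⟩
    rw [← Quotient.out_eq c₁, ← Quotient.out_eq c₂]
    exact Quotient.sound hiso
  have hcount : cubicFieldCountOfDisc d ≤ Ψ.ncard := by
    rw [cubicFieldCountOfDisc, ← Nat.card_coe_set_eq]
    exact Nat.card_le_card_of_injective Φ hΦ
  -- `#{v ∈ T : v ∤ 3} ≤ ω(f)`
  have hprime : ∀ v : HeightOneSpectrum (𝓞 k), ∃ ℓ : ℕ, ℓ.Prime ∧
      ∀ m : ℤ, ((m : ℤ) : 𝓞 k) ∈ v.asIdeal ↔ (ℓ : ℤ) ∣ m := exists_ratPrime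
  choose ℓ hℓ hℓiff using hprime
  have hfilter : (T.filter fun v => (3 : 𝓞 k) ∉ v.asIdeal).card ≤ f.natAbs.primeFactors.card := by
    refine Finset.card_le_card_of_injOn ℓ (fun v hv => ?_) ?_
    · obtain ⟨hvT, hv3⟩ := Finset.mem_filter.mp hv
      have hdvd : (ℓ v : ℤ) ∣ 3 * d := (hℓiff v (3 * d)).mp ((hT v).mp hvT)
      have hℓ3 : ℓ v ≠ 3 := by
        intro h3
        exact hv3 (by have := (hℓiff v 3).mpr (by rw [h3]; norm_num); exact_mod_cast this)
      have hcop : IsCoprime (ℓ v : ℤ) 3 := by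
        rw [Int.isCoprime_iff_gcd_eq_one, show (3 : ℤ) = ((3 : ℕ) : ℤ) from rfl, Int.gcd_natCast_natCast]
        exact (Nat.coprime_primes (hℓ v) Nat.prime_three).mpr hℓ3
      have hdvd' : (ℓ v : ℤ) ∣ f :=
        Prime.dvd_of_dvd_pow (Nat.prime_iff_prime_int.mp (hℓ v)) (hcop.dvd_of_dvd_mul_left hdvd)
      exact Finset.mem_coe.mpr (Nat.mem_primeFactors.mpr
        ⟨hℓ v, Int.natCast_dvd.mp hdvd', Int.natAbs_ne_zero.mpr hf⟩)
    · intro v _ w _ hvw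
      have hv : ((ℓ v : ℤ) : 𝓞 k) ∈ v.asIdeal := (hℓiff v (ℓ v)).mpr dvd_rfl
      have hw : ((ℓ v : ℤ) : 𝓞 k) ∈ w.asIdeal := by
        have := (hℓiff w (ℓ w)).mpr dvd_rfl
        rwa [← hvw] at this
      exact eq_of_natCast_mem_of_finrank_eq_one hk (hℓ v) v w hv hw
  calc cubicFieldCountOfDisc d ≤ Ψ.ncard := hcount
    _ ≤ 3 ^ S.card * Nat.card {c : ClassGroup (𝓞 k) // c ^ 3 = 1} := hΨcard
    _ ≤ 3 ^ (Nat.card (𝓞 k ⧸ Ideal.span {(9 : 𝓞 k)}) + f.natAbs.primeFactors.card) *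
          Nat.card {c : ClassGroup (𝓞 k) // c ^ 3 = 1} :=
        Nat.mul_le_mul_right _
          (Nat.pow_le_pow_right (by norm_num) (hScard.trans (Nat.add_le_add_left hfilter _)))

end Aux

/-! ### The count -/

/-- **`#{K : d_K = f²}/≅ ≤ 3⁹ · 3^{ω(f)}`** (`f ≠ 0`): `cubicFieldCountOfDisc_sq_le_aux` at `k := ℚ`,
where `#(ℤ/9) = 9` and `#Cl(ℤ)[3] = 1`. [cite: DavenportHeilbronn1971, §6] -/
theorem cubicFieldCountOfDisc_sq_le {f : ℤ} (hf : f ≠ 0) :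
    cubicFieldCountOfDisc (f ^ 2) ≤ 3 ^ 9 * 3 ^ f.natAbs.primeFactors.card := by
  have h := cubicFieldCountOfDisc_sq_le_aux (k := ℚ) (Module.finrank_self ℚ) hf
  have h9 : Nat.card (𝓞 ℚ ⧸ Ideal.span {(9 : 𝓞 ℚ)}) = 9 := by
    rw [← absNorm_eq_card, show (9 : 𝓞 ℚ) = (((9 : ℕ) : ℤ) : 𝓞 ℚ) by norm_num,
      absNorm_span_natCast, Module.finrank_self, pow_one]
  have hCl : Nat.card {c : ClassGroup (𝓞 ℚ) // c ^ 3 = 1} ≤ 1 := by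
    calc Nat.card {c : ClassGroup (𝓞 ℚ) // c ^ 3 = 1} ≤ Nat.card (ClassGroup (𝓞 ℚ)) :=
          Finite.card_subtype_le _
      _ = 1 := by
        rw [Nat.card_eq_fintype_card]
        exact Rat.classNumber_eq
  rw [h9] at h
  calc cubicFieldCountOfDisc (f ^ 2) ≤ _ := h
    _ ≤ 3 ^ (9 + f.natAbs.primeFactors.card) * 1 := Nat.mul_le_mul_left _ hCl
    _ = 3 ^ 9 * 3 ^ f.natAbs.primeFactors.card := by rw [mul_one, pow_add]

end Literature.NumberTheory.CubicFields

end
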